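import Summits.AtomisticToContinuum.HydrodynamicLimit.Theorems.SpecularDiceHopf.Negative.TwoSphereTrajectory

/-!
# Negative lane of crux `SpecularDiceHopf` (2/2): property (H) has teeth

Route `AnosovDiceHopf`, crux `SpecularDiceHopf` (stmt-AtomisticToContinuum-13414). A SMALL-MODEL FACT
(refuter, `--supports`; no positive route statement is asserted): the conclusion of the crux,
`InfiniteHardSphereFlow.HasOneSphereHopfProperty`, is not a tautology of the D4 vocabulary, so any proof
must use the hypotheses (OVY limit state, regular stationary state).

* `isTrajectory_S₀`: the two head-on paths of part 1 solve the infinite hard-sphere equations of motion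
  (`IsInfiniteHardSphereTrajectory`: hard core, local finiteness, continuity, free flight, pairwise
  non-grazing elastic collision from left limits).
* `Φ₀ : InfiniteHardSphereFlow (Fin 3) 1` — an explicit inhabitant of Alexander's hypothesis structure
  (good set `{ω₀}`, constant flow map `t ↦ ω_t`, tracking by the explicit paths; every field verified).
* `not_hasOneSphereHopfProperty : ¬ Φ₀.HasOneSphereHopfProperty (Measure.dirac ω₀)`: head-on collisions
  have Lambert point `0`; `{0}` is Lebesgue-null in the disc while the atom `(ω₀, p₀)` has Campbell mass
  `1`. (`δ_{ω₀}` is neither translation invariant nor entropy-regular — the hypotheses of the crux are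
  load-bearing; compare the vacuous direction `hasOneSphereHopfProperty_dirac_empty` of the D4 file.)
-/

noncomputable section

open MeasureTheory ProbabilityTheory Set Filter Function Metric
open scoped ENNReal Topology InnerProductSpace RealInnerProductSpace
open Literature.Analysis.FunctionSpaces Literature.Analysis.FluidPDE
open Literature.MathematicalPhysics.KineticTheory

namespace Summit.AtomisticToContinuum.HydrodynamicLimit.Theorems.SpecularDiceHopf.Negative

local notation "E³" => EuclideanSpace ℝ (Fin 3)
local notation "E²" => EuclideanSpace ℝ (Fin 2)


/-! ## The two paths solve the infinite hard-sphere equations of motion -/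

/-- **The two head-on paths solve the infinite hard-sphere equations of motion** (diameter `1`). -/
theorem isTrajectory_S₀ : IsInfiniteHardSphereTrajectory 1 S₀ trajFn where
  hardCore t p hp q hq hpq := by
    rcases mem_S₀.1 hp with rfl | rfl <;> rcases mem_S₀.1 hq with rfl | rfl
    · exact absurd rfl hpq
    · rw [trajFn_p₀, trajFn_q₀]
      exact one_le_norm_fst_sub t
    · rw [trajFn_p₀, trajFn_q₀, norm_sub_rev]
      exact one_le_norm_fst_sub t
    · exact absurd rfl hpq
  locFinite r a b :=
    ((Set.finite_singleton _).insert _).subset (inter_subset_left.trans collisionEvents_subset)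
  pos_continuous p hp := by
    rcases mem_S₀.1 hp with rfl | rfl
    · have h : (fun t => (trajFn p₀ t).1) = fun t : ℝ => if 2⁻¹ ≤ t then -(t • u) else -u + t • u := by
        funext t
        rw [trajFn_p₀]
        unfold γp
        split_ifs <;> rfl
      rw [h]
      exact Continuous.if_le (by fun_prop) (by fun_prop) continuous_const continuous_id
        (fun t ht => by subst ht; module)
    · have h : (fun t => (trajFn q₀ t).1) = fun t : ℝ => if 2⁻¹ ≤ t then t • u else u - t • u := by
        funext t
        rw [trajFn_q₀]
        unfold γq
        split_ifs <;> rfl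
      rw [h]
      exact Continuous.if_le (by fun_prop) (by fun_prop) continuous_const continuous_id
        (fun t ht => by subst ht; module)
  free p hp s t hst hfree := by
    rcases mem_S₀.1 hp with rfl | rfl
    · by_cases hs : 2⁻¹ ≤ s
      · have ht : 2⁻¹ ≤ t := hs.trans hst
        simp only [trajFn_p₀, γp, hs, ht, ↓reduceIte]
        exact Prod.ext (by dsimp only; module) rfl
      · by_cases ht : 2⁻¹ ≤ t
        · exact absurd mem_collisionEvents_p₀ (hfree 2⁻¹ ⟨not_le.1 hs, ht⟩)
        · simp only [trajFn_p₀, γp, hs, ht, ↓reduceIte]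
          exact Prod.ext (by dsimp only; module) rfl
    · by_cases hs : 2⁻¹ ≤ s
      · have ht : 2⁻¹ ≤ t := hs.trans hst
        simp only [trajFn_q₀, γq, hs, ht, ↓reduceIte]
        exact Prod.ext (by dsimp only; module) rfl
      · by_cases ht : 2⁻¹ ≤ t
        · exact absurd mem_collisionEvents_q₀ (hfree 2⁻¹ ⟨not_le.1 hs, ht⟩)
        · simp only [trajFn_q₀, γq, hs, ht, ↓reduceIte]
          exact Prod.ext (by dsimp only; module) rfl
  binary p hp q hq hpq t hcontact := by
    rcases mem_S₀.1 hp with rfl | rfl <;> rcases mem_S₀.1 hq with rfl | rfl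
    · exact absurd rfl hpq
    · -- `p₀` hits `q₀`
      rw [trajFn_p₀, trajFn_q₀, norm_fst_sub_eq_one_iff] at hcontact
      subst hcontact
      refine ⟨fun q' hq' hq'p _ => ?_, u, -u, ?_, ?_, ?_, ?_⟩
      · rcases mem_S₀.1 hq' with rfl | rfl
        · exact absurd rfl hq'p
        · rfl
      · refine Filter.Tendsto.congr' ?_ tendsto_const_nhds
        filter_upwards [self_mem_nhdsWithin] with s hs
        have hs' : s < 2⁻¹ := hs
        show u = (trajFn p₀ s).2
        rw [trajFn_p₀]
        unfold γp
        rw [if_neg (not_le.2 hs')]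
      · refine Filter.Tendsto.congr' ?_ tendsto_const_nhds
        filter_upwards [self_mem_nhdsWithin] with s hs
        have hs' : s < 2⁻¹ := hs
        show -u = (trajFn q₀ s).2
        rw [trajFn_q₀]
        unfold γq
        rw [if_neg (not_le.2 hs')]
      · rw [trajFn_p₀, trajFn_q₀, fst_sub, if_pos le_rfl,
          show u - -u = (2 : ℝ) • u by module, real_inner_smul_left, real_inner_smul_right, inner_u_u]
        norm_num
      · rw [trajFn_p₀, trajFn_q₀, fst_sub, if_pos le_rfl, reflect_head_on₁ _ (by norm_num)]
        unfold γp
        rw [if_pos le_rfl]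
    · -- `q₀` hits `p₀`
      rw [trajFn_p₀, trajFn_q₀, norm_sub_rev, norm_fst_sub_eq_one_iff] at hcontact
      subst hcontact
      refine ⟨fun q' hq' hq'p _ => ?_, -u, u, ?_, ?_, ?_, ?_⟩
      · rcases mem_S₀.1 hq' with rfl | rfl
        · rfl
        · exact absurd rfl hq'p
      · refine Filter.Tendsto.congr' ?_ tendsto_const_nhds
        filter_upwards [self_mem_nhdsWithin] with s hs
        have hs' : s < 2⁻¹ := hs
        show -u = (trajFn q₀ s).2
        rw [trajFn_q₀]
        unfold γq
        rw [if_neg (not_le.2 hs')]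
      · refine Filter.Tendsto.congr' ?_ tendsto_const_nhds
        filter_upwards [self_mem_nhdsWithin] with s hs
        have hs' : s < 2⁻¹ := hs
        show u = (trajFn p₀ s).2
        rw [trajFn_p₀]
        unfold γp
        rw [if_neg (not_le.2 hs')]
      · rw [trajFn_p₀, trajFn_q₀, fst_sub', if_pos le_rfl,
          show -u - u = (-2 : ℝ) • u by module, real_inner_smul_left, real_inner_smul_right, inner_u_u]
        norm_num
      · rw [trajFn_p₀, trajFn_q₀, fst_sub', if_pos le_rfl, reflect_head_on₂ _ (by norm_num)]
        unfold γq
        rw [if_pos le_rfl]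
    · exact absurd rfl hpq

/-! ## The flow -/

/-- **A genuine inhabitant of Alexander's hypothesis structure**: the two-sphere head-on flow (good set
`{ω₀}`; the flow map is the constant `t ↦ ω_t`, tracking by the explicit paths). -/
def Φ₀ : InfiniteHardSphereFlow (Fin 3) 1 where
  flow t _ := ωt t
  traj _ r t := trajFn r t
  good := {ω₀}
  measurableSet_good := measurableSet_ω₀
  good_subset := by
    intro ω hω
    change ω = ω₀ at hω
    subst hω
    exact isHardCore_ω₀
  measurable_flow t := measurable_const
  flow_zero := by
    intro ω hω
    change ω = ω₀ at hω
    subst hω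
    exact ωt_zero
  flow_add := by
    intro s t ω hω hωt
    change ωt t = ω₀ at hωt
    have h0 := t_eq_zero_of_ωt_eq hωt
    subst h0
    show ωt (s + 0) = ωt s
    rw [add_zero]
  traj_zero := by
    intro ω hω p hp
    change ω = ω₀ at hω
    subst hω
    rcases mem_ω₀.1 hp with rfl | rfl
    · show trajFn p₀ 0 = p₀
      rw [trajFn_p₀, γp_zero]
    · show trajFn q₀ 0 = q₀
      rw [trajFn_q₀, γq_zero]
  coe_flow := by
    intro ω hω t
    change ω = ω₀ at hω
    subst hω
    show ({γp t, γq t} : Set (E³ × E³)) = (fun p => trajFn p t) '' S₀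
    simp only [S₀, Set.image_pair, trajFn_p₀, trajFn_q₀]
  traj_flow := by
    intro s t ω hω hωt p hp
    change ω = ω₀ at hω
    subst hω
    change ωt t = ω₀ at hωt
    have h0 := t_eq_zero_of_ωt_eq hωt
    subst h0
    show trajFn (trajFn p 0) s = trajFn p (s + 0)
    rw [add_zero]
    rcases mem_ω₀.1 hp with rfl | rfl
    · rw [trajFn_p₀ 0, γp_zero]
    · rw [trajFn_q₀ 0, γq_zero]
  isTrajectory := by
    intro ω hω
    change ω = ω₀ at hω
    subst hω
    exact isTrajectory_S₀

/-! ## The next collision of `p₀` and its Lambert point -/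

/-- Local finiteness of the collision times of `p₀`. -/
theorem finite_collisionTimes_p₀ (b : ℝ) :
    (TaggedParticle.collisionTimes 1 S₀ trajFn p₀ ∩ Ioc 0 b).Finite := by
  rw [collisionTimes_p₀]
  exact (Set.finite_singleton _).subset inter_subset_left

/-- `p₀` has a next collision (generic form). -/
theorem hasNextCollision_S₀_p₀ : TaggedParticle.HasNextCollision 1 S₀ trajFn p₀ := by
  show (TaggedParticle.collisionTimes 1 S₀ trajFn p₀ ∩ Ioi 0).Nonempty
  rw [collisionTimes_p₀]
  exact ⟨2⁻¹, rfl, show (0 : ℝ) < 2⁻¹ by norm_num⟩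

/-- `p₀` has a next collision along `Φ₀`. -/
theorem hasNextCollision_p₀ : Φ₀.HasNextCollision ω₀ p₀ :=
  hasNextCollision_S₀_p₀

/-- The next collision time of `p₀` is `1/2`. -/
theorem nextCollisionTime_p₀ : TaggedParticle.nextCollisionTime 1 S₀ trajFn p₀ = 2⁻¹ := by
  rw [TaggedParticle.nextCollisionTime, collisionTimes_p₀,
    inter_eq_left.2 (singleton_subset_iff.2 (show (2⁻¹ : ℝ) ∈ Ioi 0 by rw [mem_Ioi]; norm_num)),
    csInf_singleton]

/-- The partner of `p₀`'s next collision is `q₀`. -/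
theorem nextPartner_p₀ : TaggedParticle.nextPartner 1 S₀ trajFn p₀ = q₀ := by
  obtain ⟨hS, hne, -⟩ :=
    TaggedParticle.nextPartner_spec finite_collisionTimes_p₀ hasNextCollision_S₀_p₀
  rcases mem_S₀.1 hS with h | h
  · exact absurd h hne
  · exact h

/-- Head-on: the outgoing (= incoming) Lambert point of `p₀`'s next collision is the CENTRE of the
disc. -/
theorem nextLambertPoint_p₀ : Φ₀.nextLambertPoint ω₀ p₀ = 0 := by
  show TaggedParticle.nextLambertPoint 1 S₀ trajFn id p₀ = 0
  simp only [TaggedParticle.nextLambertPoint, TaggedParticle.nextNormal, TaggedParticle.nextRelVel,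
    nextPartner_p₀, nextCollisionTime_p₀, trajFn_p₀, trajFn_q₀, inv_one, one_smul, id]
  rw [fst_sub, if_pos le_rfl]
  have h2 : (γp 2⁻¹).2 - (γq 2⁻¹).2 = (2 : ℝ) • ((-(2 * 2⁻¹) : ℝ) • u) := by
    simp only [γp, γq, le_refl, ↓reduceIte]
    module
  rw [h2, lambertPoint, Lambert.coords_smul, Lambert.coords_self, smul_zero, smul_zero]

/-! ## (H) fails for `(Φ₀, δ_{ω₀})` -/

/-- **Property (H) has teeth.** Under the two-sphere head-on flow, the Dirac law at `ω₀` does NOT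
have the one-sphere Hopf property: both particles collide, their next-collision Lambert point is the
atom `0`, and `{0}` is Lebesgue-null in the disc. -/
theorem not_hasOneSphereHopfProperty : ¬ Φ₀.HasOneSphereHopfProperty (Measure.dirac ω₀) := by
  intro hH
  have hS : MeasurableSet ((univ : Set (PointConfig (E³ × E³) × E³ × ℝ)) ×ˢ ({0} : Set E²)) :=
    MeasurableSet.univ.prod (measurableSet_singleton 0)
  have hnull : ((PointProcess.campbellMeasure (Measure.dirac ω₀)).map
      (TaggedParticle.everythingElse (V := E³) (id : E³ → E³))).prod
      TaggedParticle.lambertDiscMeasure ((univ : Set (PointConfig (E³ × E³) × E³ × ℝ)) ×ˢ ({0} : Set E²)) = 0 := by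
    refine le_antisymm ?_ (zero_le)
    calc _ ≤ ((PointProcess.campbellMeasure (Measure.dirac ω₀)).map
          (TaggedParticle.everythingElse (V := E³) (id : E³ → E³))) univ *
          TaggedParticle.lambertDiscMeasure {0} := Measure.prod_prod_le _ _
      _ = 0 := by
        have h0 : TaggedParticle.lambertDiscMeasure ({0} : Set E²) = 0 := by
          rw [TaggedParticle.lambertDiscMeasure_eq, Measure.restrict_apply (measurableSet_singleton 0)]
          exact measure_mono_null inter_subset_left (measure_singleton 0)
        rw [h0, mul_zero]
  have h0 := hH _ hS hnull
  -- the atom `(ω₀, p₀)` lies in the set declared null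
  have hsub : ({ω₀} : Set (PointConfig (E³ × E³))) ×ˢ ({p₀} : Set (E³ × E³)) ⊆
      {z | Φ₀.HasNextCollision z.1 z.2} ∩
        (fun z => (TaggedParticle.everythingElse (V := E³) (id : E³ → E³) z,
          Φ₀.nextLambertPoint z.1 z.2)) ⁻¹'
          ((univ : Set (PointConfig (E³ × E³) × E³ × ℝ)) ×ˢ ({0} : Set E²)) := by
    rintro ⟨ω, p⟩ ⟨hω, hp⟩
    have hω' : ω = ω₀ := hω
    have hp' : p = p₀ := hp
    subst hω' hp'
    refine ⟨hasNextCollision_p₀, mem_univ _, ?_⟩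
    show Φ₀.nextLambertPoint ω₀ p₀ ∈ ({0} : Set E²)
    rw [nextLambertPoint_p₀]
    exact mem_singleton 0
  -- and has Campbell mass one
  have hB : MeasurableSet (({ω₀} : Set (PointConfig (E³ × E³))) ×ˢ ({p₀} : Set (E³ × E³))) :=
    measurableSet_ω₀.prod (measurableSet_singleton p₀)
  have hmeas : Measurable fun ω : PointConfig (E³ × E³) =>
      ω.toMeasure (Prod.mk ω ⁻¹' (({ω₀} : Set (PointConfig (E³ × E³))) ×ˢ ({p₀} : Set (E³ × E³)))) :=
    Kernel.measurable_kernel_prodMk_left (κ := PointConfig.countKernel) hB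
  have hone : PointProcess.campbellMeasure (Measure.dirac ω₀)
      (({ω₀} : Set (PointConfig (E³ × E³))) ×ˢ ({p₀} : Set (E³ × E³))) = 1 := by
    rw [PointProcess.campbellMeasure_apply _ hB, lintegral_dirac' _ hmeas,
      mk_preimage_prod_right (mem_singleton ω₀),
      PointConfig.toMeasure_apply _ (measurableSet_singleton p₀), count_ω₀_p₀]
    simp
  have hle : PointProcess.campbellMeasure (Measure.dirac ω₀)
      (({ω₀} : Set (PointConfig (E³ × E³))) ×ˢ ({p₀} : Set (E³ × E³))) ≤ 0 :=
    (measure_mono hsub).trans_eq h0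
  rw [hone] at hle
  exact absurd hle (by norm_num)

/-- Packaging: the conclusion predicate of `SpecularDiceHopf` is not a tautology of the D4
vocabulary — some infinite hard-sphere flow and some law violate (H). -/
theorem exists_not_hasOneSphereHopfProperty :
    ∃ (Φ : InfiniteHardSphereFlow (Fin 3) 1) (μ : Measure (PointConfig (E³ × E³))),
      IsProbabilityMeasure μ ∧ ¬ Φ.HasOneSphereHopfProperty μ :=
  ⟨Φ₀, Measure.dirac ω₀, inferInstance, not_hasOneSphereHopfProperty⟩

end Summit.AtomisticToContinuum.HydrodynamicLimit.Theorems.SpecularDiceHopf.Negative
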